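import Summits.AtomisticToContinuum.HydrodynamicLimit.Theorems.OneFlightGossipEngineEquilibriumClampedCollisionalWindowLDCompositionC1

/-!
# Free sparse dice: the no-kick comparison for window exponential moments (line `Sketch` / card `free-sparse-dice`)

Crux `Summit.AtomisticToContinuum.HydrodynamicLimit.Theses.TwoClocks.ClampedTransferWindowLD` (stmt-AtomisticToContinuum-16623;
`Iff.rfl` with the landed `Theorems.ClampedTransferCoin.ClampedTransferWindowLD`, C′). Helper file of the line lead
(`--supports stmt-AtomisticToContinuum-16623`): the one proved asset of the line `Sketch` (ideator-1's `Sketch.lean`), rebuilt on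
the landed `ClampedTransferCoin` vocabulary so that it is importable, with the quantifier bookkeeping of the line's transfer step.

* `mul_lintegral_le_lintegral_prod_of_eqOn` — for measures `μ` (data) and `ν` (kicks, s-finite), a measurable "no-kick" set `A`
  of finite mass, a measurable `f : Ω × K → ℝ≥0∞` and ANY `g : Ω → ℝ≥0∞` with `f (ω, k) = g ω` for `k ∈ A`:
  `ν A * ∫⁻ g ∂μ ≤ ∫⁻ f ∂(μ.prod ν)` (Tonelli and monotonicity: conditioning a product law on the no-kick cylinder costs exactly
  its probability; no measurability of `g` is needed).
* `lintegral_exp_le_of_freeKicks` — the window-LD currency form: if `ν A ≥ e^{-η c}` and the kicked exponential moment is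
  `≤ e^{ε c}`, the unkicked one is `≤ e^{(η + ε) c}`.
* `clampedTransferWindowLD_of_freeKicks` — the line's transfer step, kernel-checked: C′ follows from its "free-kicks form" (same
  quantifier prefix; innermost, for each row, SOME kick space `(K, ν)` with a no-kick set of mass `≥ e^{-ε(N+1)}` on which the kicked
  row functional IS `w⁻¹(X_r − A_r)`, and kicked exponential moment `≤ e^{ε(N+1)}`), by running it at accuracy `ε/2`. The kick space
  is existentially quantified, so this records the bookkeeping only (in particular the kick rate must be tied to the accuracy `ε`,
  i.e. chosen AFTER `β` — thresholds `σ₀, V₀, β₀` of a kicked family may not depend on the rate); the content of the line is the choice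
  of the rate-`ε/w` Maxwellian-kicked hard-sphere gas as `(K, ν)`, whose window LD (C⁺) stays open.
-/

noncomputable section

open MeasureTheory ProbabilityTheory Set Filter
open scoped ENNReal BigOperators
open Literature.Analysis.FluidPDE Literature.MathematicalPhysics.KineticTheory
open Literature.Analysis.FunctionSpaces (Torus.partialDeriv Torus.IsSmooth)

namespace Summit.AtomisticToContinuum.HydrodynamicLimit.Theorems.ClampedTransferCoin

/-! ## The comparison on a product space -/

section Comparison

variable {Ω K : Type*} [MeasurableSpace Ω] [MeasurableSpace K]

/-- **No-kick comparison.** If `f (ω, k) = g ω` whenever `k` lies in the "no-kick" set `A` (measurable, of finite `ν`-mass) and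
`f` is measurable, then `ν A * ∫⁻ g ∂μ ≤ ∫⁻ f ∂(μ.prod ν)` (Tonelli; `f ≥ 0` off the cylinder `Ω × A`; `g` arbitrary). -/
theorem mul_lintegral_le_lintegral_prod_of_eqOn (μ : Measure Ω) (ν : Measure K) [SFinite ν]
    {A : Set K} (hA : MeasurableSet A) (hAtop : ν A ≠ ∞) {f : Ω × K → ℝ≥0∞} (hf : Measurable f)
    (g : Ω → ℝ≥0∞) (hfg : ∀ ω, ∀ k ∈ A, f (ω, k) = g ω) :
    ν A * ∫⁻ ω, g ω ∂μ ≤ ∫⁻ p, f p ∂(μ.prod ν) := by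
  rw [lintegral_prod _ hf.aemeasurable]
  calc ν A * ∫⁻ ω, g ω ∂μ = ∫⁻ ω, g ω * ν A ∂μ := by
        rw [lintegral_mul_const' _ _ hAtop, mul_comm]
    _ = ∫⁻ ω, ∫⁻ _ in A, g ω ∂ν ∂μ := by
        refine lintegral_congr fun ω => ?_
        rw [setLIntegral_const]
    _ = ∫⁻ ω, ∫⁻ k in A, f (ω, k) ∂ν ∂μ := by
        refine lintegral_congr fun ω => ?_
        exact setLIntegral_congr_fun hA (fun k hk => (hfg ω k hk).symm)
    _ ≤ ∫⁻ ω, ∫⁻ k, f (ω, k) ∂ν ∂μ :=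
        lintegral_mono fun ω => setLIntegral_le_lintegral _ _

/-- **No-kick comparison, division form.** With moreover `ν A ≠ 0`: `∫⁻ g ∂μ ≤ (ν A)⁻¹ * ∫⁻ f ∂(μ.prod ν)`. -/
theorem lintegral_le_inv_mul_lintegral_prod_of_eqOn (μ : Measure Ω) (ν : Measure K) [SFinite ν]
    {A : Set K} (hA : MeasurableSet A) (hA0 : ν A ≠ 0) (hAtop : ν A ≠ ∞) {f : Ω × K → ℝ≥0∞}
    (hf : Measurable f) (g : Ω → ℝ≥0∞) (hfg : ∀ ω, ∀ k ∈ A, f (ω, k) = g ω) :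
    ∫⁻ ω, g ω ∂μ ≤ (ν A)⁻¹ * ∫⁻ p, f p ∂(μ.prod ν) := by
  have h := mul_lintegral_le_lintegral_prod_of_eqOn μ ν hA hAtop hf g hfg
  calc ∫⁻ ω, g ω ∂μ = (ν A)⁻¹ * (ν A * ∫⁻ ω, g ω ∂μ) := by
        rw [← mul_assoc, ENNReal.inv_mul_cancel hA0 hAtop, one_mul]
    _ ≤ (ν A)⁻¹ * ∫⁻ p, f p ∂(μ.prod ν) := by gcongr

/-- **The window-LD currency form.** If the no-kick set has mass `e^{-η c} ≤ ν A < ∞`, the measurable kicked functional `Sk`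
agrees with `S` on it, and `∫ e^{β Sk} d(μ ⊗ ν) ≤ e^{ε c}`, then `∫ e^{β S} dμ ≤ e^{(η + ε) c}` (`S` need not be measurable). -/
theorem lintegral_exp_le_of_freeKicks (μ : Measure Ω) (ν : Measure K) [SFinite ν]
    {A : Set K} (hA : MeasurableSet A) (S : Ω → ℝ) {Sk : Ω × K → ℝ} (hSk : Measurable Sk)
    (hagree : ∀ ω, ∀ k ∈ A, Sk (ω, k) = S ω) {η ε c β : ℝ}
    (hνA : ENNReal.ofReal (Real.exp (-(η * c))) ≤ ν A) (hνA' : ν A ≠ ∞)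
    (hbound : ∫⁻ p, ENNReal.ofReal (Real.exp (β * Sk p)) ∂(μ.prod ν) ≤ ENNReal.ofReal (Real.exp (ε * c))) :
    ∫⁻ ω, ENNReal.ofReal (Real.exp (β * S ω)) ∂μ ≤ ENNReal.ofReal (Real.exp ((η + ε) * c)) := by
  have hpos : 0 < ENNReal.ofReal (Real.exp (-(η * c))) := ENNReal.ofReal_pos.2 (Real.exp_pos _)
  have hA0 : ν A ≠ 0 := (hpos.trans_le hνA).ne'
  have hf : Measurable fun p : Ω × K => ENNReal.ofReal (Real.exp (β * Sk p)) :=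
    ENNReal.measurable_ofReal.comp (Real.measurable_exp.comp (hSk.const_mul β))
  have h := lintegral_le_inv_mul_lintegral_prod_of_eqOn μ ν hA hA0 hνA' hf
    (fun ω => ENNReal.ofReal (Real.exp (β * S ω))) (fun ω k hk => by simp only [hagree ω k hk])
  calc ∫⁻ ω, ENNReal.ofReal (Real.exp (β * S ω)) ∂μ
      ≤ (ν A)⁻¹ * ∫⁻ p, ENNReal.ofReal (Real.exp (β * Sk p)) ∂(μ.prod ν) := h
    _ ≤ (ENNReal.ofReal (Real.exp (-(η * c))))⁻¹ * ENNReal.ofReal (Real.exp (ε * c)) := by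
        gcongr
    _ = ENNReal.ofReal (Real.exp ((η + ε) * c)) := by
        rw [← ENNReal.ofReal_inv_of_pos (Real.exp_pos _), ← ENNReal.ofReal_mul (inv_nonneg.2 (Real.exp_pos _).le),
          ← Real.exp_neg, neg_neg, ← Real.exp_add]
        congr 2
        ring

/-- **R3 · free-kick comparison** (registered stub `stub_freeKickComparison` of the line `Sketch`, card free-sparse-dice): for
s-finite `μ` (data) and `ν` (kicks), a measurable no-kick set `A` of positive finite `ν`-measure and measurable `f ≥ 0` on `Ω × K`,
`g ≥ 0` on `Ω` with `f (ω, k) = g ω` for `k ∈ A`: `∫⁻ g dμ ≤ (ν A)⁻¹ · ∫⁻ f d(μ ⊗ ν)` (Tonelli on the rectangle `univ ×ˢ A`).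
(The hypotheses `[SFinite μ]` and `hg` of the registered signature are not needed: `mul_lintegral_le_lintegral_prod_of_eqOn`.) -/
theorem stub_freeKickComparison {Ω K : Type*} [MeasurableSpace Ω] [MeasurableSpace K]
    (μ : Measure Ω) (ν : Measure K) [SFinite μ] [SFinite ν] {A : Set K} (hA : MeasurableSet A)
    (hA0 : ν A ≠ 0) (hAtop : ν A ≠ ⊤) {f : Ω × K → ℝ≥0∞} {g : Ω → ℝ≥0∞} (hf : Measurable f) (hg : Measurable g)
    (hfg : ∀ ω, ∀ k ∈ A, f (ω, k) = g ω) :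
    ∫⁻ ω, g ω ∂μ ≤ (ν A)⁻¹ * ∫⁻ p, f p ∂(μ.prod ν) :=
  (fun _ : Measurable g => lintegral_le_inv_mul_lintegral_prod_of_eqOn μ ν hA hA0 hAtop hf g hfg) hg

end Comparison

/-! ## The line's transfer step: C′ from its free-kicks form -/

/-- **C′ from free sparse dice (quantifier bookkeeping, kernel-checked).** Suppose the quantifier prefix of C′ delivers, at each
size `N` and for each of the four rows `r`, SOME kick space `(K, ν)` (a probability space), a measurable no-kick set `A` with
`ν A ≥ e^{-ε(N+1)}`, and a measurable kicked row functional `Sk` on `Phase N × K` which IS the row `w⁻¹(X_r − A_r)` of C′ on the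
no-kick cylinder and whose exponential moment under `G_N ⊗ ν` at tilt `β` is `≤ e^{ε(N+1)}`. Then C′ (`ClampedTransferWindowLD`)
holds: run the hypothesis at accuracy `ε/2` and apply `lintegral_exp_le_of_freeKicks` row by row (`e^{(ε/2 + ε/2)(N+1)}`). -/
theorem clampedTransferWindowLD_of_freeKicks
    (h : ∃ σ₀ : ℝ, 0 < σ₀ ∧ ∀ (a₀ θ₀ : ℝ) (u₀ : V3), 0 < a₀ → 0 < θ₀ → ∀ σ : ℝ, 0 < σ → σ < σ₀ →
      ∀ Φ : (N : ℕ) → Flow σ N, ∀ φ : T3 → ℝ, Torus.IsSmooth φ → ∃ V₀ : ℝ, 0 < V₀ ∧ ∀ V : ℝ, V₀ ≤ V →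
        ∃ β₀ : ℝ, 0 < β₀ ∧ ∀ β : ℝ, |β| ≤ β₀ → ∀ ε : ℝ, 0 < ε → ∃ τ₀ : ℝ, 0 < τ₀ ∧ ∀ τ : ℝ, τ₀ ≤ τ →
          ∃ N₀ : ℕ, ∀ N : ℕ, N₀ ≤ N → ∀ r : Option (Fin 3),
            ∃ (K : Type) (_ : MeasurableSpace K) (ν : Measure K) (A : Set K) (Sk : Phase N × K → ℝ),
              IsProbabilityMeasure ν ∧ MeasurableSet A ∧
              ENNReal.ofReal (Real.exp (-(ε * ((N : ℝ) + 1)))) ≤ ν A ∧ Measurable Sk ∧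
              (∀ z : Phase N, ∀ k ∈ A, Sk (z, k) =
                (window τ N)⁻¹ * Xrow σ τ V φ (Φ N) r z - (window τ N)⁻¹ * Arow σ θ₀ u₀ τ φ (Φ N) r z) ∧
              ∫⁻ p, ENNReal.ofReal (Real.exp (β * Sk p)) ∂((gibbs σ a₀ θ₀ u₀ N (Φ N)).prod ν) ≤
                ENNReal.ofReal (Real.exp (ε * ((N : ℝ) + 1)))) :
    ClampedTransferWindowLD := by
  rw [clampedTransferWindowLD_iff]
  obtain ⟨σ₀, hσ₀, h⟩ := h
  refine ⟨σ₀, hσ₀, fun a₀ θ₀ u₀ ha hθ σ hσ hσ' Φ φ hφ => ?_⟩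
  obtain ⟨V₀, hV₀, h⟩ := h a₀ θ₀ u₀ ha hθ σ hσ hσ' Φ φ hφ
  refine ⟨V₀, hV₀, fun V hV => ?_⟩
  obtain ⟨β₀, hβ₀, h⟩ := h V hV
  refine ⟨β₀, hβ₀, fun β hβ ε hε => ?_⟩
  obtain ⟨τ₀, hτ₀, h⟩ := h β hβ (ε / 2) (half_pos hε)
  refine ⟨τ₀, hτ₀, fun τ hτ => ?_⟩
  obtain ⟨N₀, h⟩ := h τ hτ
  refine ⟨N₀, fun N hN => ?_⟩
  have hrow : ∀ r : Option (Fin 3),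
      ∫⁻ z, ENNReal.ofReal (Real.exp (β * ((window τ N)⁻¹ * Xrow σ τ V φ (Φ N) r z -
          (window τ N)⁻¹ * Arow σ θ₀ u₀ τ φ (Φ N) r z))) ∂(gibbs σ a₀ θ₀ u₀ N (Φ N)) ≤
        ENNReal.ofReal (Real.exp (ε * ((N : ℝ) + 1))) := by
    intro r
    obtain ⟨K, mK, ν, A, Sk, hν, hA, hνA, hSk, hagree, hbound⟩ := h N hN r
    have key := lintegral_exp_le_of_freeKicks (gibbs σ a₀ θ₀ u₀ N (Φ N)) ν hA
      (fun z => (window τ N)⁻¹ * Xrow σ τ V φ (Φ N) r z - (window τ N)⁻¹ * Arow σ θ₀ u₀ τ φ (Φ N) r z)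
      hSk hagree hνA (measure_ne_top ν A) hbound
    have e : (ε / 2 + ε / 2) * ((N : ℝ) + 1) = ε * ((N : ℝ) + 1) := by ring
    rw [e] at key
    exact key
  exact ⟨fun k => hrow (some k), hrow none⟩

end Summit.AtomisticToContinuum.HydrodynamicLimit.Theorems.ClampedTransferCoin

end
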